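import Summits.ValiantsHypothesis.ValiantsHypothesis.Theorems.DepthWindowPDerivSpan
import Literature.Computability.AlgebraicComplexity.CircuitGateSemantics
import Literature.Computability.AlgebraicComplexity.DepthReductionProofs
import Mathlib.LinearAlgebra.Dimension.Constructions
import Mathlib.Logic.Equiv.Fin.Basic
import Mathlib.Data.Fin.Tuple.Basic
import Mathlib.Data.Complex.Basic
import Mathlib.Data.List.GetD
import HarnessLib

/-!
# Route `DepthWindow`, g8 — the hard instance for `¬ HomRel 1 1`: `e_{2r}` on `Fin r × Fin N`

The lower-bound half of Nisan–Wigderson's partial-derivative argument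
[cite: NisanWigderson1996, Thm. 1], specialised to a TRANSVERSAL sub-family of derivatives so that
the rank computation is elementary:

* `kron_eq_zero` — the `0/1` pattern `∏ᵢ [fᵢ ≠ gᵢ]` on `(Fin r → Fin N)²` is nonsingular for
  `N ≥ 2` (it is the `r`-th Kronecker power of `J − I`; proved by induction on `r`, peeling one
  coordinate with `offdiag_sum_eq_zero`);
* `esymmBlock r N = [1 + X_x (x ∈ Fin r × Fin N) ; ∏ₓ (1 + X_x)]` — a block of relative
  product-depth `1` (`depth_esymmBlock`) whose last value is `∏ₓ (1 + Xₓ)`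
  (`getD_gateValues_esymmBlock`), with degree-`2r` component the elementary symmetric polynomial
  `esymmE r N = e_{2r}` (`homogeneousComponent_prod_one_add`);
* transversals `S_f = {(i, f i)}`: the coefficient of `x_{S_g}` in `∂_{S_f} e_{2r}` is
  `∏ᵢ [f i ≠ g i]` (`coeff_transv_dlist_esymmE`), hence the `N^r` polynomials `∂_{S_f} e_{2r}` are
  linearly independent (`linearIndependent_transv_dlist`).

Gate model: [cite: Burgisser2000, Def. 2.1].  Nothing in this file bears on `VP ≠ VNP`.
-/

set_option linter.dupNamespace false

namespace Summit.ValiantsHypothesis.ValiantsHypothesis.Theorems.DepthWindow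

open MvPolynomial Literature.Computability.AlgebraicComplexity ArithCircuit
open Literature.Computability.AlgebraicComplexity.DepthReduction

/-! ### The disjointness pattern `∏ᵢ [fᵢ ≠ gᵢ]` is nonsingular (Kronecker power of `J − I`) -/

section Kron

/-- `J − I` is injective on `ℂ^N` for `N ≥ 2`: if `∑_{a ≠ b} μ a = 0` for every `b` then `μ = 0`. -/
theorem offdiag_sum_eq_zero {N : ℕ} (hN : 2 ≤ N) (μ : Fin N → ℂ)
    (h : ∀ b : Fin N, ∑ a, (if a ≠ b then μ a else 0) = 0) : ∀ b, μ b = 0 := by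
  classical
  have hsub : ∀ b : Fin N, ∑ a, μ a - μ b = 0 := by
    intro b
    have hb := h b
    have : ∑ a, (if a ≠ b then μ a else 0) = ∑ a, μ a - μ b := by
      rw [show (fun a => if a ≠ b then μ a else 0) = fun a => μ a - if a = b then μ a else 0 from
        funext fun a => by by_cases hab : a = b <;> simp [hab], Finset.sum_sub_distrib,
        Finset.sum_ite_eq' Finset.univ b, if_pos (Finset.mem_univ b)]
    rw [this] at hb
    exact hb
  -- all `μ b` equal the total `T`, hence `N • T = T`, hence `T = 0`
  set T := ∑ a, μ a with hT
  have hμ : ∀ b, μ b = T := fun b => by have := hsub b; linear_combination -this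
  have hNT : (N : ℂ) * T = T := by
    conv_rhs => rw [hT, Finset.sum_congr rfl fun b _ => hμ b]
    rw [Finset.sum_const, Finset.card_univ, Fintype.card_fin, nsmul_eq_mul]
  have hN1 : (N : ℂ) - 1 ≠ 0 := by
    rw [sub_ne_zero]; exact_mod_cast (show N ≠ 1 by omega)
  have hT0 : T = 0 := by
    have : ((N : ℂ) - 1) * T = 0 := by rw [sub_mul, one_mul, hNT, sub_self]
    rcases mul_eq_zero.mp this with h | h
    · exact absurd h hN1
    · exact h
  intro b; rw [hμ b, hT0]

/-- **The disjointness pattern is nonsingular.**  If `∑_f λ_f ∏ᵢ [f i ≠ g i] = 0` for every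
`g : Fin r → Fin N` (`N ≥ 2`), then `λ = 0` — the matrix is the `r`-th Kronecker power of `J − I`.
This replaces Gottlieb's rank theorem in Nisan–Wigderson's argument for the transversal
sub-family of derivatives used below. [cite: NisanWigderson1996, Thm. 1] -/
theorem kron_eq_zero {N : ℕ} (hN : 2 ≤ N) :
    ∀ (r : ℕ) (lam : (Fin r → Fin N) → ℂ),
      (∀ g : Fin r → Fin N, ∑ f, lam f * (if ∀ i, f i ≠ g i then 1 else 0) = 0) →
      ∀ f, lam f = 0
  | 0, lam, h, f => by
      have hf := h f
      rw [Fintype.sum_eq_single f (fun f' hf' => absurd (Subsingleton.elim f' f) hf')] at hf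
      simpa using hf
  | r + 1, lam, h, f => by
      classical
      -- `μ g' a := ∑_{f'} λ (cons a f') ∏ [f' i ≠ g' i]`
      have hsplit : ∀ (b : Fin N) (g' : Fin r → Fin N),
          ∑ a, (if a ≠ b then (∑ f' : Fin r → Fin N,
            lam (Fin.cons a f') * (if ∀ i, f' i ≠ g' i then 1 else 0)) else 0) = 0 := by
        intro b g'
        have hg := h (Fin.cons b g')
        have hg' : ∑ p : Fin N × (Fin r → Fin N), lam (Fin.cons p.1 p.2) *
            (if ∀ i, (Fin.cons p.1 p.2 : Fin (r + 1) → Fin N) i ≠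
              (Fin.cons b g' : Fin (r + 1) → Fin N) i then 1 else 0) = 0 := by
          rw [Fintype.sum_equiv (Fin.consEquiv fun _ => Fin N)
            (fun p : Fin N × (Fin r → Fin N) => lam (Fin.cons p.1 p.2) *
              (if ∀ i, (Fin.cons p.1 p.2 : Fin (r + 1) → Fin N) i ≠
                (Fin.cons b g' : Fin (r + 1) → Fin N) i then 1 else 0))
            (fun f => lam f * (if ∀ i, f i ≠ (Fin.cons b g' : Fin (r + 1) → Fin N) i then 1 else 0))
            (fun p => rfl)]
          exact hg
        rw [Fintype.sum_prod_type] at hg'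
        refine Eq.trans ?_ hg'
        refine Finset.sum_congr rfl fun a _ => ?_
        by_cases hab : a = b
        · rw [if_neg (not_not.mpr hab)]
          symm
          refine Finset.sum_eq_zero fun f' _ => ?_
          rw [if_neg, mul_zero]
          intro hall
          exact hall 0 (by simp [hab])
        · rw [if_pos hab]
          refine Finset.sum_congr rfl fun f' _ => ?_
          congr 1
          have hiff : (∀ i : Fin (r + 1), (Fin.cons a f' : Fin (r + 1) → Fin N) i ≠
              (Fin.cons b g' : Fin (r + 1) → Fin N) i) ↔ ∀ i, f' i ≠ g' i := by
            rw [Fin.forall_fin_succ]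
            simp only [Fin.cons_zero, Fin.cons_succ]
            exact ⟨fun h => h.2, fun h => ⟨hab, h⟩⟩
          exact if_congr hiff.symm rfl rfl
      have hμ : ∀ (g' : Fin r → Fin N) (a : Fin N),
          ∑ f' : Fin r → Fin N, lam (Fin.cons a f') * (if ∀ i, f' i ≠ g' i then 1 else 0) = 0 :=
        fun g' => offdiag_sum_eq_zero hN _ fun b => hsplit b g'
      have hcons : ∀ a f', lam (Fin.cons a f') = 0 :=
        fun a => kron_eq_zero hN r (fun f' => lam (Fin.cons a f')) fun g' => hμ g' a
      rw [← Fin.cons_self_tail f]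
      exact hcons _ _

end Kron

/-! ### The hard instance: `∏_{x ∈ Fin r × Fin N} (1 + X_x)` as a block of relative depth `1` -/

section Instance

variable (r N : ℕ)

/-- The sum gate `1 + X_x` for the `i`-th variable `x = finProdFinEquiv⁻¹ i`. -/
noncomputable def oneAddGate (i : Fin (r * N)) : Gate ℂ (Fin r × Fin N) :=
  Gate.sum [((1 : ℂ), Operand.const 1), (1, Operand.var (finProdFinEquiv.symm i))]

/-- The block `[1 + X_x (x ∈ Fin r × Fin N); ∏ₓ (1 + X_x)]` of relative product-depth `1`. -/
noncomputable def esymmBlock : List (Gate ℂ (Fin r × Fin N)) :=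
  List.ofFn (oneAddGate r N) ++ [Gate.prod (List.ofFn fun i : Fin (r * N) => Operand.gate i.val)]

/-- The block has `rN + 1` gates. -/
theorem length_esymmBlock : (esymmBlock r N).length = r * N + 1 := by
  simp [esymmBlock]

/-- The sum layer references no gates. -/
theorem oneAdd_argsBelow : ∀ g ∈ List.ofFn (oneAddGate r N), ∀ u ∈ g.args, u.RefsBelow 0 := by
  intro g hg u hu
  rw [List.mem_ofFn] at hg
  obtain ⟨i, rfl⟩ := hg
  simp only [oneAddGate, Gate.args, List.map_cons, List.map_nil, List.mem_cons,
    List.not_mem_nil, or_false] at hu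
  rcases hu with rfl | rfl <;> trivial

/-- Depth entries of the sum layer are `0`. -/
theorem gateWDepths_oneAdd :
    gateWDepths prodWeight (List.ofFn (oneAddGate r N)) = (List.ofFn (oneAddGate r N)).map fun _ => 0 := by
  have h := gateWDepths_layer prodWeight [] (List.ofFn (oneAddGate r N)) (oneAdd_argsBelow r N)
  rw [List.nil_append] at h
  rw [h]
  simp only [gateWDepths, List.foldl_nil, List.nil_append]
  refine List.map_congr_left fun g hg => ?_
  rw [List.mem_ofFn] at hg
  obtain ⟨i, rfl⟩ := hg
  simp [oneAddGate, prodWeight, Gate.isProd, Gate.args, Operand.depthIn]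

/-- **Relative depth `1`.**  Every depth entry of the block is `≤ 1`. [cite: LimayeSrinivasanTavenas2025, §1] -/
theorem depth_esymmBlock : ∀ n ∈ gateWDepths prodWeight (esymmBlock r N), n ≤ 1 := by
  intro n hn
  rw [esymmBlock, gateWDepths_append_singleton, gateWDepths_oneAdd, List.mem_append,
    List.mem_singleton] at hn
  rcases hn with hn | rfl
  · obtain ⟨_, _, rfl⟩ := List.mem_map.mp hn; exact Nat.zero_le _
  · have h1 : prodWeight (Gate.prod (List.ofFn fun i : Fin (r * N) => Operand.gate i.val) :
        Gate ℂ (Fin r × Fin N)) = 1 := by simp [prodWeight, Gate.isProd]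
    rw [h1]
    have : ((Gate.prod (List.ofFn fun i : Fin (r * N) => Operand.gate i.val) :
        Gate ℂ (Fin r × Fin N)).args.map
        (Operand.depthIn (((List.ofFn (oneAddGate r N)).map fun _ => 0)))).foldr max 0 ≤ 0 := by
      refine foldr_max_le fun x hx => ?_
      obtain ⟨u, hu, rfl⟩ := List.mem_map.mp hx
      simp only [Gate.args, List.mem_ofFn] at hu
      obtain ⟨i, rfl⟩ := hu
      simp only [Operand.depthIn, List.getD_eq_getElem?_getD, List.getElem?_map]
      cases ((List.ofFn (oneAddGate r N))[i.val]? : Option (Gate ℂ (Fin r × Fin N))) <;> simp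
    omega

/-- Values of the sum layer. -/
theorem getD_gateValues_oneAdd (i : Fin (r * N)) :
    (gateValues (List.ofFn (oneAddGate r N))).getD i.val 0 = 1 + X (finProdFinEquiv.symm i) := by
  have h := gateValues_layer [] (List.ofFn (oneAddGate r N)) (oneAdd_argsBelow r N)
  rw [List.nil_append] at h
  rw [h]
  simp only [gateValues, List.foldl_nil, List.nil_append]
  rw [List.getD_eq_getElem _ _ (by simp), List.getElem_map, List.getElem_ofFn]
  simp [oneAddGate, Gate.eval, Operand.eval]

/-- **The block computes `∏ₓ (1 + Xₓ)`** at its last gate. [cite: Burgisser2000, Def. 2.1] -/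
theorem getD_gateValues_esymmBlock :
    (gateValues (esymmBlock r N)).getD (r * N) 0 = ∏ x : Fin r × Fin N, (1 + X x) := by
  rw [esymmBlock, gateValues_append_singleton, List.getD_append_right _ _ _ _ (by simp),
    gateValues_length, List.length_ofFn, Nat.sub_self, List.getD_cons_zero]
  rw [show (Gate.prod (List.ofFn fun i : Fin (r * N) => Operand.gate i.val) :
      Gate ℂ (Fin r × Fin N)).eval (gateValues (List.ofFn (oneAddGate r N))) =
      ((List.ofFn fun i : Fin (r * N) => (Operand.gate i.val : Operand ℂ (Fin r × Fin N))).map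
        fun u => u.eval (gateValues (List.ofFn (oneAddGate r N)))).prod from rfl,
    List.map_ofFn, List.prod_ofFn]
  rw [← Equiv.prod_comp finProdFinEquiv.symm (fun x : Fin r × Fin N => (1 + X x : MvPolynomial _ ℂ))]
  refine Fintype.prod_congr _ _ fun i => ?_
  exact getD_gateValues_oneAdd r N i

/-- The degree-`2r` elementary symmetric polynomial in the variables `Fin r × Fin N`. -/
noncomputable def esymmE : MvPolynomial (Fin r × Fin N) ℂ :=
  ∑ T ∈ (Finset.univ : Finset (Fin r × Fin N)).powersetCard (2 * r), xmon T

/-- `esymmE` is homogeneous of degree `2r`. -/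
theorem isHomogeneous_esymmE : (esymmE r N).IsHomogeneous (2 * r) := by
  refine IsHomogeneous.sum _ _ _ fun T hT => ?_
  rw [Finset.mem_powersetCard] at hT
  rw [← hT.2]
  exact isHomogeneous_xmon T

/-- **The degree-`2r` component of `∏ₓ (1 + Xₓ)` is `e_{2r}`.** -/
theorem homogeneousComponent_prod_one_add :
    homogeneousComponent (2 * r) (∏ x : Fin r × Fin N, (1 + X x : MvPolynomial _ ℂ)) = esymmE r N := by
  classical
  have h : ∏ x : Fin r × Fin N, (1 + X x : MvPolynomial _ ℂ) =
      ∑ T ∈ (Finset.univ : Finset (Fin r × Fin N)).powerset, xmon T := by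
    simp_rw [add_comm (1 : MvPolynomial _ ℂ)]
    rw [Finset.prod_add]
    refine Finset.sum_congr rfl fun T _ => ?_
    rw [Finset.prod_const_one, mul_one]; rfl
  rw [h, map_sum, esymmE, Finset.powersetCard_eq_filter, Finset.sum_filter]
  refine Finset.sum_congr rfl fun T _ => ?_
  rw [homogeneousComponent_of_mem (isHomogeneous_xmon T)]
  by_cases hT : T.card = 2 * r
  · rw [if_pos hT.symm, if_pos hT]
  · rw [if_neg (fun h => hT h.symm), if_neg hT]

end Instance

/-! ### Transversal derivatives of `e_{2r}` -/

section Transversal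

variable {r N : ℕ}

/-- The transversal `S_f = {(i, f i)}` of `f : Fin r → Fin N`. -/
noncomputable def transv (f : Fin r → Fin N) : Finset (Fin r × Fin N) :=
  Finset.univ.image fun i => (i, f i)

/-- The transversal as a list of variables. -/
noncomputable def transvList (f : Fin r → Fin N) : List (Fin r × Fin N) :=
  List.ofFn fun i => (i, f i)

/-- The transversal list is duplicate-free. -/
theorem nodup_transvList (f : Fin r → Fin N) : (transvList f).Nodup :=
  List.nodup_ofFn_ofInjective fun _ _ h => (Prod.mk.inj h).1

/-- Length of the transversal list. -/
theorem length_transvList (f : Fin r → Fin N) : (transvList f).length = r := by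
  simp [transvList]

/-- The transversal list enumerates the transversal. -/
theorem toFinset_transvList (f : Fin r → Fin N) : (transvList f).toFinset = transv f := by
  ext x
  rw [List.mem_toFinset, transvList, List.mem_ofFn, transv, Finset.mem_image]
  constructor
  · rintro ⟨i, rfl⟩; exact ⟨i, Finset.mem_univ _, rfl⟩
  · rintro ⟨i, -, rfl⟩; exact ⟨i, rfl⟩

/-- Membership in the transversal list. -/
theorem forall_mem_transvList_iff (f : Fin r → Fin N) (T : Finset (Fin r × Fin N)) :
    (∀ s ∈ transvList f, s ∈ T) ↔ transv f ⊆ T := by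
  rw [← toFinset_transvList]
  constructor
  · intro h x hx; exact h x (List.mem_toFinset.mp hx)
  · intro h x hx; exact h (List.mem_toFinset.mpr hx)

/-- A transversal has `r` elements. -/
theorem card_transv (f : Fin r → Fin N) : (transv f).card = r := by
  rw [transv, Finset.card_image_of_injective _ fun i j h => (Prod.mk.inj h).1, Finset.card_fin]

/-- Two transversals are disjoint iff the functions differ everywhere. -/
theorem disjoint_transv_iff (f g : Fin r → Fin N) :
    Disjoint (transv f) (transv g) ↔ ∀ i, f i ≠ g i := by
  rw [Finset.disjoint_left]
  constructor
  · intro h i hi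
    exact h (Finset.mem_image.mpr ⟨i, Finset.mem_univ _, rfl⟩)
      (Finset.mem_image.mpr ⟨i, Finset.mem_univ _, by rw [hi]⟩)
  · intro h x hx hx'
    obtain ⟨i, -, rfl⟩ := Finset.mem_image.mp hx
    obtain ⟨j, -, hj⟩ := Finset.mem_image.mp hx'
    obtain ⟨rfl, hji⟩ := Prod.mk.inj hj
    exact h j hji.symm

/-- **Coefficient pattern.**  The coefficient of the transversal monomial `x_{S_g}` in the
transversal derivative `∂_{S_f} e_{2r}` is `[S_f ∩ S_g = ∅] = ∏ᵢ [f i ≠ g i]`.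
[cite: NisanWigderson1996, Thm. 1] -/
theorem coeff_transv_dlist_esymmE (f g : Fin r → Fin N) :
    coeff (ind (transv g)) (dlist (transvList f) (esymmE r N)) =
      if ∀ i, f i ≠ g i then 1 else 0 := by
  classical
  rw [esymmE, dlist_sum, coeff_sum]
  simp_rw [dlist_xmon (transvList f) (nodup_transvList f), forall_mem_transvList_iff,
    toFinset_transvList]
  have hterm : ∀ T : Finset (Fin r × Fin N),
      coeff (ind (transv g)) (if transv f ⊆ T then (xmon (T \ transv f) : MvPolynomial _ ℂ) else 0) =
        if T = transv f ∪ transv g ∧ Disjoint (transv f) (transv g) then 1 else 0 := by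
    intro T
    by_cases hT : transv f ⊆ T
    · rw [if_pos hT, coeff_ind_xmon]
      by_cases h2 : T \ transv f = transv g
      · rw [if_pos h2, if_pos]
        refine ⟨by rw [← h2, Finset.union_sdiff_of_subset hT], ?_⟩
        rw [← h2]; exact Finset.disjoint_sdiff
      · rw [if_neg h2, if_neg]
        rintro ⟨rfl, hd⟩
        exact h2 (by rw [Finset.union_sdiff_left, Finset.sdiff_eq_self_of_disjoint hd.symm])
    · rw [if_neg hT, coeff_zero, if_neg]
      rintro ⟨rfl, -⟩
      exact hT Finset.subset_union_left
  simp_rw [hterm]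
  by_cases hd : Disjoint (transv f) (transv g)
  · rw [if_pos ((disjoint_transv_iff f g).mp hd), Finset.sum_eq_single (transv f ∪ transv g)]
    · rw [if_pos ⟨rfl, hd⟩]
    · intro T _ hT; rw [if_neg (fun h => hT h.1)]
    · intro h
      exfalso; apply h
      rw [Finset.mem_powersetCard]
      exact ⟨Finset.subset_univ _, by rw [Finset.card_union_of_disjoint hd, card_transv, card_transv,
        two_mul]⟩
  · rw [if_neg (fun h => hd ((disjoint_transv_iff f g).mpr h))]
    exact Finset.sum_eq_zero fun T _ => if_neg fun h => hd h.2

/-- **Linear independence of the transversal derivatives of `e_{2r}`** (`N ≥ 2`): the `N^r`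
polynomials `∂_{S_f} e_{2r}` are linearly independent. [cite: NisanWigderson1996, Thm. 1] -/
theorem linearIndependent_transv_dlist (hN : 2 ≤ N) :
    LinearIndependent ℂ fun f : Fin r → Fin N => dlist (transvList f) (esymmE r N) := by
  classical
  rw [Fintype.linearIndependent_iff]
  intro c hc
  refine kron_eq_zero hN r c fun g => ?_
  have := congrArg (coeff (ind (transv g))) hc
  rw [coeff_sum, coeff_zero] at this
  simp_rw [coeff_smul, coeff_transv_dlist_esymmE, smul_eq_mul] at this
  exact this

/-- `e_{2r} ≠ 0` when `N ≥ 2`. -/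
theorem esymmE_ne_zero (hN : 2 ≤ N) : esymmE r N ≠ 0 := by
  classical
  intro h
  have := coeff_transv_dlist_esymmE (r := r) (N := N) (fun _ => ⟨0, by omega⟩) (fun _ => ⟨1, by omega⟩)
  rw [h, dlist_zero, coeff_zero, if_pos (fun i => by simp [Fin.ext_iff])] at this
  exact zero_ne_one this

end Transversal


end Summit.ValiantsHypothesis.ValiantsHypothesis.Theorems.DepthWindow
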